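import Literature.AlgebraicGeometry.GroupSchemes.UnitComponentClopen
import HarnessLib

/-!
# F0 ∕ P6b — sub-line «CONNECTED–ÉTALE» (`Cruxes/HLiu418/Lines/F0_P6b_ConnectedEtale.lean` ED. 1), stub `stub_b1a_unitComponent` (b1a):
# CLOSED BY NAME — road σ2 «clopen `D(e)` + functor of points» (★ `GroupSchemes/UnitComponentClopen`)

Cell `hodgecm-mathlib` (D-0151), FLOOR 0, P6 «MOD programme», crux item stmt-HodgeConjecture-24832 (HLiu418), route
`HCCMUnconditional`; sub-line `Lines/F0_P6b_ConnectedEtale.lean` ED. 1 (F0P6b-plan (g0); ref1 BOX P6b-4 GREEN), registered-to-be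
stub **`stub_b1a_unitComponent`** (:63 of the cand `F0_P6b_ConnectedEtale.ed1.cand.v1.F0P6bplan-g0.lean`, sha16 8210ab19d71568b2).
This file restates the stub's TYPE binder for binder, with the line's `def IsUnitComponent G G₀ j := IsMonHom j ∧ IsOpenImmersion j.left
∧ IsClosedImmersion j.left ∧ ConnectedSpace G₀.left` UNFOLDED (the Lines module is a crux workfile, not built on the farm), and proves it
by ★ `Literature.AlgebraicGeometry.GroupSchemes.UnitComponentClopen.exists_unitComponent` ([Tate1997FiniteFlatGroupSchemes] (3.7) (I):
the clopen `D(e)` through the unit section of a finite group scheme over a henselian local ring is a connected open-and-closed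
subgroup scheme; no flatness, no Hopf algebra).  The line's next edition closes the hole BY NAME:
`theorem stub_b1a_unitComponent … := fun R _ _ G _ h => UnitComponentClopen.exists_unitComponent R G h` (δ-unfolding
`IsUnitComponent`).  `--supports stmt-HodgeConjecture-24832`; count-neutral: HC_CM is proved only modulo the printed citations until
rung 0 closes, and this file changes no count.

## References
* [Tate1997FiniteFlatGroupSchemes] J. Tate, *Finite flat group schemes*, in: Cornell–Silverman–Stevens (eds.), *Modular Forms and
  Fermat's Last Theorem* (Springer 1997), (3.7) (I) and item 2) of its proof (pp. 141–142).
* [StacksProject] The Stacks Project, Tag 04GG (Algebra, Lemma 10.153.3 (10)).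
-/

noncomputable section

set_option autoImplicit false
set_option linter.dupNamespace false

open CategoryTheory CategoryTheory.Limits AlgebraicGeometry MonoidalCategory CartesianMonoidalCategory
open scoped MonObj

namespace Summit.HodgeConjecture.HodgeConjecture.Cruxes.HLiu418.F0P6bConnectedEtaleStubB1aClopen

/-- **STUB `stub_b1a_unitComponent` (line `F0_P6b_ConnectedEtale` ED. 1), its type verbatim with `IsUnitComponent` unfolded** — a
finite group scheme `G` over a HENSELIAN local ring `R` (a group object of `Over (Spec R)` with `G → Spec R` finite; no flatness) has
a unit component: a group object `G₀` with a homomorphism `j : G₀ ⟶ G` whose underlying morphism is an open and closed immersion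
with connected source.  Proof: ★ `UnitComponentClopen.exists_unitComponent` at universe `0`.
[cite: Tate1997FiniteFlatGroupSchemes, (3.7) (I)] [cite: StacksProject, Tag 04GG] -/
theorem stub_b1a_unitComponent_holds :
    ∀ (R : Type) [CommRing R] [HenselianLocalRing R] (G : Over (Spec (.of R))) [GrpObj G],
      IsFinite G.hom →
        ∃ (G₀ : Over (Spec (.of R))) (_ : GrpObj G₀) (j : G₀ ⟶ G),
          IsMonHom j ∧ IsOpenImmersion j.left ∧ IsClosedImmersion j.left ∧ ConnectedSpace G₀.left :=
  fun R _ _ G _ hG => Literature.AlgebraicGeometry.GroupSchemes.UnitComponentClopen.exists_unitComponent R G hG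

end Summit.HodgeConjecture.HodgeConjecture.Cruxes.HLiu418.F0P6bConnectedEtaleStubB1aClopen

end
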